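import Summits.ResolutionOfSingularities.ResolutionOfSingularities.Theorems.FrobeniusLadderFRationalResolutionAffineSpaceRegular
import Summits.ResolutionOfSingularities.ResolutionOfSingularities.Theorems.FrobeniusLadderFRationalResolutionAffineSpaceBirational
import Literature.AlgebraicGeometry.Resolution.ResolutionOfSingularities
import HarnessLib

/-!
# Resolutions pull back along affine spaces

Support file for crux stmt-ResolutionOfSingularities-15317 (`FrobeniusLadder.FRationalResolution`),
line `Sketch`, continuation seat c3, wave 3, theme (B). **If `X` has a resolution of singularities
then so has `𝔸ⁿ_X`** (`X` locally Noetherian): for a resolution `π : X' → X`, the base change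
`AffineSpace.map (Fin n) π : 𝔸ⁿ_{X'} → 𝔸ⁿ_X` is proper (base change, Mathlib
`AffineSpace.isPullback_map`), birational (`stub_isBirational_affineSpace_map`, p141453) and its
source is regular (`stub_isRegular_affineSpace`, p142822: a polynomial ring over a regular ring is
regular). The first step of "resolutions pull back along smooth morphisms"; used to carry rung 4′
from the `A_m` surfaces to the hypersurfaces `yz + x₀^(m+1) = 0` in any number of variables.
[folklore]
-/

-- single-problem summit: the doubled namespace component is forced
set_option linter.dupNamespace false

noncomputable section

namespace Summit.ResolutionOfSingularities.ResolutionOfSingularities.Theorems.FRationalResolution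

open CategoryTheory AlgebraicGeometry TopologicalSpace
open Literature.AlgebraicGeometry.Resolution

/-- **RESOLUTIONS PULL BACK ALONG AFFINE SPACES.** If a locally Noetherian scheme `X` has a
resolution of singularities `π : X' → X`, then for every `n` the affine space `𝔸ⁿ_X` has the
resolution `𝔸ⁿ_{X'} → 𝔸ⁿ_X` (proper by base change, birational by
`stub_isBirational_affineSpace_map`, regular source by `stub_isRegular_affineSpace`). [folklore] -/
theorem hasResolution_affineSpace (n : ℕ) (X : Scheme.{0}) [IsLocallyNoetherian X]
    (h : Scheme.HasResolution X) : Scheme.HasResolution (AffineSpace (Fin n) X) := by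
  obtain ⟨X', π, hπ⟩ := h
  haveI := hπ.isProper
  haveI : IsLocallyNoetherian X' := LocallyOfFiniteType.isLocallyNoetherian π
  refine ⟨AffineSpace (Fin n) X', AffineSpace.map (Fin n) π, ⟨?_, ?_, ?_⟩⟩
  · exact MorphismProperty.IsStableUnderBaseChange.of_isPullback (P := @IsProper)
      (AffineSpace.isPullback_map (n := Fin n) π).flip hπ.isProper
  · exact stub_isBirational_affineSpace_map n X' X π hπ.isBirational
  · exact stub_isRegular_affineSpace n X' hπ.isRegular

end Summit.ResolutionOfSingularities.ResolutionOfSingularities.Theorems.FRationalResolution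

end
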